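import Literature.AlgebraicGeometry.Resolution.KangarooAtlasCert

/-!
# Kangaroo atlas certificates, part 2: coordinate-subspace centres and the obliquity order test

Companion to `KangarooAtlasCert.lean` (same sparse model: `x^q + F(y₁,…,y_m)` over `𝔽_p`,
`q = pᵉ`, `F` kept CLEANED, `shade = ord F − Σ rᵢ`). Two computable additions, each followed by
rows re-checked by `decide`:

1. **Coordinate-subspace centres** (the atlas' second walk, rule `bm`, implemented twice in
   Python as `engineA_cc.py` / `engineB_cc.py`; this is the third implementation). For
   `S ⊆ {1,…,m}` the candidate centre is `C_S = {x = 0, yᵢ = 0 (i ∈ S)}`. It is ADMISSIBLE iff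
   (i) `q ≤` the order of the re-cleaned `F` at a general closed point of `C_S` — so `C_S` lies in
   the equimultiple locus of `x^q + F` and the blow-up is permissible
   [cite: HauserPerlega2019PRIMS, §2 ("permissible … contained in the equimultiple loci")]; and
   (ii) that order minus `Σ_{i∈S} rᵢ` equals the shade at the point — the germ of `C_S` lies in the
   top locus of `(ord, shade)`; rule `bm` adds (iii) `S ⊇` the exceptional components through the
   point — the atlas' transcription (every component treated as "old"; the atlas does not track
   Bierstone–Milman's years) of "`s(x) := #{H ∈ E : x ∈ H}`", which enters the invariant before the
   next order ("`inv_I(x) := (s, inv_J(x))`", §7 p. 635), and of "the centre `C` of each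
   admissible blowing-up lies inside the intersection of the components of `E` that pass through a
   point of `C`" (§5, printed p. 627); the centres of the algorithm are "given by the maximum locus of
   `(inv_I, J_I)` on `cosupp I_j`" (Thm 7.1 (2)) [cite: BierstoneMilman2008, §5 Step I Case B (p. 627), §7 (p. 635), Thm 7.1 (2)].
   The walk blows up the admissible `C_S` of largest dimension, all ties. The general-point order in (i)/(ii) is computed
   monomial by monomial: `y_N^a·y_S^b` (`N` the complement of `S`) contributes `|b|` if some `bᵢ` is
   not divisible by `q`, else `|b| + min {p^{v_p(aᵢ)} : i ∈ N, q ∤ aᵢ}` — the lowest non-`q`-th-power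
   term of its Taylor expansion at a general point, by Lucas' theorem on binomial coefficients
   mod `p` [folklore]; monomials of a cleaned `F` always contribute. For the test (i) alone this
   agrees with the plain `I(C_S)`-adic order `min |b|` (a monomial contributes `< q` to one iff it
   does to the other). Chart `y_j` (`j ∈ S`): `yᵢ ↦ yᵢ·y_j` for `i ∈ S∖{j}`, division by `y_j^q`, new
   multiplicity `r_j = ord_{C_S} F − q` (`D' = D^strict + (ord_Z F − q)·Y'`, [cite: Hauser2010, §F–§G]).

2. **The obliquity order test** behind condition (4) of the Kangaroo Theorem. Hauser 2010, §I
   (p. 23), verbatim: "A nonzero polynomial `P = yʳg(y)` with `r ∈ ℕᵐ` and `g` homogeneous of degree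
   `k` is called oblique with parameters `p`, `r` and `k` if `P` has no nontrivial `p`th power
   polynomial factor and if there is a vector `t = (0, t_ℓ, …, t₁) ∈ (K*)ᵐ` so that the polynomial
   `P⁺(y) = (y + t·y_m)ʳ g(y + t·y_m)` has, after deleting all `p`th power monomials from it, order
   `k + 1` with respect to the variables `y_ℓ, …, y₁`. … It is checked by computation that the
   condition `ord^p_z P⁺ ≥ k + 1` on `P⁺` is a prerequisite for the occurence of a kangaroo point as
   in the theorem. Moh's result implies `ord^p_z P⁺ ≤ k + 1`, so that equality must hold."
   [cite: Hauser2010, §I p. 23]. Hauser–Perlega 2019, §3 Theorem (4), verbatim: "Factorize `F` into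
   `F(x) = xʳ·G(x)` with `rᵢ = ord_{(xᵢ)} F`, for `i ∈ T`, and `G` a homogeneous polynomial of degree
   `u = deg F − Σ_{i∈T} rᵢ`. If `Q_T` denotes the ideal of `K[[x₁,…,xₙ]]` generated by `xᵢ − tᵢx₁`,
   for `i ∈ T∖{1}`, and `xᵢ`, for `i ∉ T`, then `ord^{mod pᵉ}_{Q_T} F > u`, where `ord^{mod pᵉ}_Q F`
   denotes the maximum of the orders `ord_Q(F + H^{pᵉ})` over all polynomials `H`"; here `F` is
   the initial form, `x₁` the chart variable and `T = {1} ∪ {i : tᵢ ≠ 0}` (§2)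
   [cite: HauserPerlega2019PRIMS, §2, §3 Theorem (4)]. In the coordinates `xᵢ' = xᵢ − tᵢx₁` the
   maximum over `H` is attained by deleting the `q`-th-power monomials, so the test is computable:
   shear the initial form (`yᵢ ↦ yᵢ + bᵢ·y_j`), delete `q`-th powers, take the order in the variables
   other than `y_j`, compare with `u`. Below `u` is formed with a multiplicity vector passed as an
   argument: the atlas' accumulated exceptional multiplicities `r` (every monomial of the cleaned
   `F = yʳ·G` is divisible by `yʳ`, so `rᵢ ≤ ord_{(yᵢ)}(in F)` and the test with the atlas' `r` implies
   the printed one), or the printed `ord_{(xᵢ)}` of the initial form (`initialExponents`).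
   DERIVED HERE (elementary, not a cited statement): for a point blow-up at an equiconstant point
   with `q ∣ o = ord F`, the cleaned transform has order `≤ (o − q) + w` with `w` the test's order,
   whence `shade' ≤ w − Σ_{i ∉ T} rᵢ` and an increase `shade' ≥ shade + 1` forces `w ≥ u + 1` with the
   atlas' `r`; for homogeneous `F` Moh's bound gives `w ≤ u + p^{e−1}` [cite: Moh1987, Stability Theorem].

3. **The oasis bound** (surfaces). Hauser 2010 §J, verbatim: "call the antelope point the point `a`
   immediately prior to a kangaroo point `a'`, and the oasis point the last point `a°` below `a` where
   none of the exceptional components through `a` has appeared yet. … Fact. The shade of `f` drops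
   between the oasis point `a°` and the antelope point `a` of a kangaroo point `a'` at least to the
   integer part of its half, `shade_a f ≤ ⌊½·shade_{a°} f°⌋`. … It seems challenging to establish a
   similar statement for singular three-folds in four-space." [cite: Hauser2010, §J p. 24] — recorded
   as the Boolean `oasisBound` so that atlas rows (in dimension 3, where it is printed for surfaces,
   and in dimension 4, where it is printed as open) can be tabulated against it.

Everything here is a CERTIFICATE of finitely many computations plus typed vocabulary; nothing is a
theorem about resolution of singularities.
-/

namespace Literature.AlgebraicGeometry.Resolution.KangarooAtlasCert

/-! ## Small list utilities -/

/-- minimum of a list, `none` for `[]`. [folklore] -/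
def minList : List ℕ → Option ℕ
  | [] => none
  | a :: l => some (l.foldl min a)

/-- `p`-adic valuation of `n` (fuel-bounded recursion; `0` for `n = 0` or `p ≤ 1`). [folklore] -/
def vpAux (p : ℕ) : ℕ → ℕ → ℕ
  | 0, _ => 0
  | fuel + 1, n => if n = 0 ∨ p ≤ 1 ∨ n % p ≠ 0 then 0 else vpAux p fuel (n / p) + 1

/-- `p`-adic valuation `v_p(n)`. [folklore] -/
def vp (p n : ℕ) : ℕ := vpAux p n n

/-- all sublists of a list of indices (increasing if the input is). [folklore] -/
def subsets : List ℕ → List (List ℕ)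
  | [] => [[]]
  | a :: l => (subsets l).map (fun s => a :: s) ++ subsets l

/-- membership test as a Boolean. [folklore] -/
def memB (i : ℕ) (S : List ℕ) : Bool := S.any (fun k => k == i)

/-! ## 1. Coordinate-subspace centres -/

/-- `Σ_{i∈S} eᵢ`: the `I(C_S)`-adic order of the monomial `y^e`, `C_S = {yᵢ = 0 (i ∈ S)}`. [folklore] -/
def degIn (S : List ℕ) (e : Mon) : ℕ := (S.map (fun i => e.getD i 0)).sum

/-- order of `F` along `C_S` (the `I(C_S)`-adic order, `min_e Σ_{i∈S} eᵢ`); `none` for `F = 0`.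
[cite: HauserPerlega2019PRIMS, §2 (`ord_P`)] -/
def ordAlong (S : List ℕ) (P : Poly) : Option ℕ := minList (P.map (fun t => degIn S t.1))

/-- contribution of the monomial `y^e = y_N^a y_S^b` to the order of the re-cleaned `F` at a GENERAL closed point of
`C_S` (`m` variables): `|b|` if `q ∤ bᵢ` for some `i ∈ S`, else `|b| + min {p^{v_p(aᵢ)} : i ∉ S, q ∤ aᵢ}` (Lucas);
`none` if every exponent is divisible by `q` (never the case for a monomial of a cleaned `F`).
(engine convention of the atlas, rule text KANGAROO-ATLAS-CC-bm §0 (i)) [folklore] -/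
def monoGenOrd (p q m : ℕ) (S : List ℕ) (e : Mon) : Option ℕ :=
  if S.any (fun i => e.getD i 0 % q != 0) then some (degIn S e)
  else
    match minList (((List.range m).filter (fun i => !(memB i S) && e.getD i 0 % q != 0)).map
        (fun i => p ^ vp p (e.getD i 0))) with
    | none => none
    | some c => some (degIn S e + c)

/-- order of the re-cleaned `F` at a general closed point of `C_S`; `none` = `+∞`. (engine convention) [folklore] -/
def genOrd (p q m : ℕ) (S : List ℕ) (P : Poly) : Option ℕ :=
  minList (P.filterMap (fun t => monoGenOrd p q m S t.1))

/-- admissibility of `C_S` at the state `(F, r)` with exceptional components `exc` (indices) through the point: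
(iii, rule `bm` only) `exc ⊆ S`; (i) general-point order `≥ q`; (ii) general-point order `− Σ_{i∈S} rᵢ = shade`.
[cite: BierstoneMilman2008, §5 Step I Case B (p. 627)] [cite: HauserPerlega2019PRIMS, §2] -/
def admissible (bm : Bool) (p q m : ℕ) (F : Poly) (r exc : List ℕ) (S : List ℕ) : Bool :=
  (!bm || exc.all (fun i => memB i S)) &&
    match genOrd p q m S F with
    | none => false
    | some o => decide (q ≤ o) && decide (o - degIn S r = ord F - r.sum)

/-- the centres the walk blows up: admissible `S` of MINIMAL cardinality (largest dimension), all ties, as increasing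
index lists; `S = {1,…,m}` (the point) is admissible whenever the point is `q`-fold, so the list is then nonempty.
(engine convention) [cite: BierstoneMilman2008, Thm 7.1 (2)] -/
def admissibleCentres (bm : Bool) (p q m : ℕ) (F : Poly) (r exc : List ℕ) : List (List ℕ) :=
  let all := (subsets (List.range m)).filter (fun S => S != [] && admissible bm p q m F r exc S)
  match minList (all.map List.length) with
  | none => []
  | some k => all.filter (fun S => S.length == k)

/-- blow-up of `C_S` in the chart `y_j` (`j ∈ S`): `yᵢ ↦ yᵢ·y_j` (`i ∈ S∖{j}`), strict transform divided by `y_j^q`: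
the exponent of `y_j` becomes `Σ_{i∈S} eᵢ − q`. [cite: Hauser2010, §G] [cite: HauserPerlega2019PRIMS, §2] -/
def blowupS (S : List ℕ) (j q : ℕ) (P : Poly) : Poly := P.map (fun t => (t.1.set j (degIn S t.1 - q), t.2))

/-- a state of the coordinate-centre walk: cleaned `F`, exceptional multiplicities `r`, and the indices `exc` of the
exceptional components through the point (a component of multiplicity `0` may still pass through it).
[cite: Hauser2010, §F] -/
structure CState where
  F : Poly
  r : List ℕ
  exc : List ℕ
  deriving Repr, DecidableEq

/-- shade of a `CState`. [cite: Hauser2010, §F] -/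
def CState.shade (s : CState) : ℕ := ord s.F - s.r.sum

/-- one step of the coordinate-centre walk: blow up `C_S`, chart `j`, translate by `b`, re-clean; `none` unless `C_S` is
equimultiple (`ord_{C_S} F ≥ q`) and the new point is `q`-fold. New data: `r_j = ord_{C_S} F − q`, `j` exceptional;
a translated coordinate (`bᵢ ≠ 0`) leaves its component (`rᵢ = 0`, not exceptional). [cite: Hauser2010, §F–§G] -/
def stepS (p q : ℕ) (s : CState) (S : List ℕ) (j : ℕ) (b : List ℕ) : Option CState :=
  match ordAlong S s.F with
  | none => none
  | some oS =>
    if oS < q then none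
    else
      let G := translate p b (blowupS S j q s.F)
      if G.all (fun t => deg t.1 = 0 ∨ q ≤ deg t.1) then
        let Gc := clean q (G.filter (fun t => deg t.1 ≠ 0))
        let m := s.r.length
        let r' := (List.range m).map (fun i => if b.getD i 0 ≠ 0 then 0 else if i = j then oS - q else s.r.getD i 0)
        let exc' := (List.range m).filter (fun i => b.getD i 0 = 0 ∧ (i = j ∨ memB i s.exc))
        some ⟨Gc, r', exc'⟩
      else none

/-! ### Certified rows (variables are indexed `0, 1, 2` = `y, z, w` or `x, y, w` as stated) -/

/-- Hauser's antelope `y³z³(y² + z²)` (cleaned: `y⁵z³ + y³z⁵`), `p = q = 2`, `r = (3, 3)`, both lines exceptional,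
shade `2`: the only admissible coordinate centre is the POINT, under rule `bm` and under rule `shade` alike (along
either exceptional line the general shade is `0 ≠ 2`). (computation) [cite: Hauser2010, §G] -/
theorem hauser_antelope_centres :
    admissibleCentres true 2 2 2 [([5, 3], 1), ([3, 5], 1)] [3, 3] [0, 1] = [[0, 1]] ∧
      admissibleCentres false 2 2 2 [([5, 3], 1), ([3, 5], 1)] [3, 3] [] = [[0, 1]] := by
  decide

/-- Hauser's root `y⁷ + yz⁴` (`r = 0`, nothing exceptional, shade `5`): again only the point qualifies — along the line
`y = 0` the general order of `yz⁴` is `1 < 2`, along `z = 0` that of `y⁷ + yz⁴` is `0 + 2^{v₂(1)} = 1`.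
(computation) [cite: Hauser2010, §G] -/
theorem hauser_root_centres : admissibleCentres true 2 2 2 hauserF [0, 0] [] = [[0, 1]] := by decide

/-- The `E₈`-type fourfold root `x² + y² + z³ + w⁵` over `𝔽₂` (cleaned `F = z³ + w⁵` in `(y, z, w)`, shade `3`): the
admissible centre of largest dimension is the LINE `C_{z,w}` (the `y`-axis; general order `min(3, 5) = 3 ≥ 2`,
general shade `3`), not the point. (computation) [cite: BierstoneMilman2008, Thm 7.1 (2)] -/
theorem e8_root_centres : admissibleCentres true 2 2 3 e8F [0, 0, 0] [] = [[1, 2]] := by decide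

/-- … and blowing up that line in the chart `w` at the origin gives `z³w + w³`, `r = (0, 0, 1)`, `w` exceptional,
shade `2`. (computation) [cite: Hauser2010, §G] -/
theorem e8_root_stepS :
    stepS 2 2 ⟨e8F, [0, 0, 0], []⟩ [1, 2] 2 [0, 0, 0] = some ⟨[([0, 3, 1], 1), ([0, 0, 3], 1)], [0, 0, 1], [2]⟩ ∧
      CState.shade ⟨[([0, 3, 1], 1), ([0, 0, 3], 1)], [0, 0, 1], [2]⟩ = 2 := by
  decide

/-- Bérczi's Lemma-2 threefold `z³ + x¹² + y⁶ + w⁹y⁴ + x⁹y⁸w¹⁰` over `𝔽₃` (cleaned `F = y⁴w⁹ + x⁹y⁸w¹⁰` in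
`(x, y, w)`, `q = 3`, shade `13`): the admissible centre of largest dimension is the line `C_{y,w}` (general order
`13`), so the coordinate-centre walk does not start with the point blow-ups of the printed path.
(computation) [cite: Berczi2026, Lemma 2] [cite: BierstoneMilman2008, Thm 7.1 (2)] -/
theorem berczi_lemma2_root_centres :
    admissibleCentres true 3 3 3 [([0, 4, 9], 1), ([9, 8, 10], 1)] [0, 0, 0] [] = [[1, 2]] := by decide

/-- the dimension-4 antelope `y³z⁵w²` over `𝔽₂` (`r = (3, 5, 0)`, `y`, `z` exceptional, shade `2`): under rule `bm`
only the point is admissible (`C_{y,z}` has general shade `8 − 8 = 0`). (computation) [cite: Hauser2010, §G] -/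
theorem wh4_p2_antelope_centres :
    admissibleCentres true 2 2 3 [([3, 5, 2], 1)] [3, 5, 0] [0, 1] = [[0, 1, 2]] := by decide

/-! ## 2. The obliquity order test (Hauser (4) / Hauser–Perlega (4)) -/

/-- initial form: the monomials of least total degree. [folklore] -/
def initialForm (P : Poly) : Poly :=
  let o := ord P
  P.filter (fun t => deg t.1 = o)

/-- the shear `yᵢ ↦ yᵢ + t·y_j` on one variable `i ≠ j` (binomial theorem, coefficients mod `p`).
[cite: Hauser2010, §I p. 23 (`P⁺(y) = (y + t y_m)ʳ g(y + t y_m)`)] -/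
def shearVar (p j i t : ℕ) (P : Poly) : Poly :=
  normalize p (P.flatMap (fun m =>
    let n := m.1.getD i 0
    (List.range (n + 1)).map (fun k =>
      ((m.1.set i k).set j (m.1.getD j 0 + (n - k)), m.2 * Nat.choose n k * t ^ (n - k)))))

/-- the shear `yᵢ ↦ yᵢ + tᵢ·y_j` for every `i ≠ j` with `tᵢ ≠ 0`. [cite: Hauser2010, §I p. 23] -/
def shear (p j : ℕ) (t : List ℕ) (P : Poly) : Poly :=
  (List.range t.length).foldl (fun acc i => if i = j ∨ t.getD i 0 = 0 then acc else shearVar p j i (t.getD i 0) acc) P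

/-- Hauser's `ord^q_z P⁺`: delete the `q`-th-power monomials, then the order in the variables other than `y_j`;
`none` = `+∞` (everything deleted). [cite: Hauser2010, §I p. 23] [cite: HauserPerlega2019PRIMS, §3 Theorem (4)] -/
def pOrdAway (q j : ℕ) (P : Poly) : Option ℕ := minList ((clean q P).map (fun t => deg t.1 - t.1.getD j 0))

/-- `u = o − Σ_{i∈T} rᵢ` with `T = {j} ∪ {i : bᵢ ≠ 0}` and `o = ord F`, for a given multiplicity vector `r`.
[cite: HauserPerlega2019PRIMS, §3 Theorem (4)] -/
def uT (F : Poly) (r : List ℕ) (j : ℕ) (b : List ℕ) : ℕ :=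
  ord F - (((List.range r.length).filter (fun i => i = j ∨ b.getD i 0 ≠ 0)).map (fun i => r.getD i 0)).sum

/-- the printed multiplicities `rᵢ = ord_{(xᵢ)}(in F)`: least exponent of each variable in the initial form.
[cite: HauserPerlega2019PRIMS, §3 Theorem (4)] -/
def initialExponents (F : Poly) : List ℕ :=
  let P := initialForm F
  let m := ((F.headD ([], 0)).1).length
  (List.range m).map (fun i => (P.map (fun t => t.1.getD i 0)).foldl min (ord F))

/-- the excess `ord^q_ẑ (shear_{j,b} in F)⁺ − u` of the obliquity order test, over `ℤ`; `none` = `+∞`.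
[cite: Hauser2010, §I p. 23] [cite: HauserPerlega2019PRIMS, §3 Theorem (4)] -/
def c4Excess (p q : ℕ) (F : Poly) (r : List ℕ) (j : ℕ) (b : List ℕ) : Option ℤ :=
  match pOrdAway q j (shear p j b (initialForm F)) with
  | none => none
  | some w => some ((w : ℤ) - (uT F r j b : ℤ))

/-- condition (4) as a Boolean: `ord^{mod q}_{Q_T}(in F) > u` (`+∞` counts as true).
[cite: HauserPerlega2019PRIMS, §3 Theorem (4)] [cite: Hauser2010, §I p. 23] -/
def hpCond4 (p q : ℕ) (F : Poly) (r : List ℕ) (j : ℕ) (b : List ℕ) : Bool :=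
  match c4Excess p q F r j b with
  | none => true
  | some x => decide (1 ≤ x)

/-! ### Certified rows: the excess is exactly `1` at every kangaroo row certified in this directory -/

/-- Hauser's antelope `y⁵z³ + y³z⁵`, `r = (3, 3)`, chart `y`, point `z = 1`: the shear `z ↦ z + y` gives, mod squares,
`y⁵z³ + y³z⁵`, of `z`-order `3 = u + 1` (`u = 8 − 3 − 3 = 2 = k`) — Hauser's Example 5 (`k = 2`, order `k + 1 = 3`);
with the printed `r = ord_{(xᵢ)}` (here also `(3, 3)`) the same. At the ORIGIN of that chart (no increase) the excess
is `3 − 5 < 1`. (computation) [cite: Hauser2010, §I Examples 4–5] -/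
theorem hauser_c4 :
    c4Excess 2 2 [([5, 3], 1), ([3, 5], 1)] [3, 3] 0 [0, 1] = some 1 ∧
      initialExponents [([5, 3], 1), ([3, 5], 1)] = [3, 3] ∧
      hpCond4 2 2 [([5, 3], 1), ([3, 5], 1)] [3, 3] 0 [0, 0] = false := by
  decide

/-- the prescribed-history rows `iso-p2` (`y³z + yz³`, `r = (1, 1)`, `p = 2`) and `iso-p3` (`yz⁵ + y⁴z²`, `r = (1, 2)`,
`p = 3`, point `z = 2`): excess `1`. (computation) [cite: Hauser2010, §I p. 23] -/
theorem iso_c4 :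
    c4Excess 2 2 [([3, 1], 1), ([1, 3], 1)] [1, 1] 0 [0, 1] = some 1 ∧
      c4Excess 3 3 [([1, 5], 1), ([4, 2], 1)] [1, 2] 0 [0, 2] = some 1 := by
  decide

/-- the dimension-4 `E₈` antelope `yz²w + y²zw³`, `r = (1, 1, 1)`, chart `y`, point `(z, w) = (0, 1)` (`T = {y, w}`,
`u = 4 − 2 = 2`): initial form `yz²w`, shear `w ↦ w + y` gives `yz²w + y²z²`, mod squares `yz²w` of order `3` away
from `y`: excess `1`. (computation) [cite: HauserPerlega2019PRIMS, §3 Theorem (4)] -/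
theorem e8_c4 : c4Excess 2 2 [([1, 2, 1], 1), ([2, 1, 3], 1)] [1, 1, 1] 0 [0, 0, 1] = some 1 := by decide

/-- the dimension-4 antelope `y³z⁵w²`, `r = (3, 5, 0)`, chart `y`, point `(z, w) = (1, 0)`: excess `1`.
(computation) [cite: HauserPerlega2019PRIMS, §3 Theorem (4)] -/
theorem wh4_p2_c4 : c4Excess 2 2 [([3, 5, 2], 1)] [3, 5, 0] 0 [0, 1, 0] = some 1 := by decide

/-- Bérczi's Lemma-2 antelope `x¹⁰y²⁰w⁹ + x²⁴y³⁹w¹⁰`, `r = (10, 20, 0)`, `p = 3`, chart `x`, point `(y, w) = (1, 0)`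
(`u = 39 − 30 = 9`): the shear `y ↦ y + x` of the initial form `x¹⁰y²⁰w⁹` keeps, mod cubes, the terms with
`y`-exponent `k ∈ {1, 2, 10, 11, 19, 20}` (Lucas, `20 = (202)₃`), of order `k + 9 ≥ 10` away from `x`: excess `1`.
(computation) [cite: Berczi2026, Lemma 2] [cite: HauserPerlega2019PRIMS, §3 Theorem (4)] -/
theorem berczi_lemma2_c4 :
    c4Excess 3 3 [([10, 20, 9], 1), ([24, 39, 10], 1)] [10, 20, 0] 0 [0, 1, 0] = some 1 := by decide

/-- `q = 4` rows: the Brieskorn–Pham antelope `y²z⁶ + y¹⁰z⁵` (`r = (2, 5)`) and the prescribed binomial `y⁶z²`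
(`r = (6, 1)`), chart `y`, point `z = 1`: excess `1` (Moh allows up to `p^{e−1} = 2` here); the binomial control
`r = (6, 0)` (no increase) has excess `0`. (computation) [cite: HauserPerlega2019PRIMS, §3 Theorem (4), (9)] -/
theorem q4_c4 :
    c4Excess 2 4 [([2, 6], 1), ([10, 5], 1)] [2, 5] 0 [0, 1] = some 1 ∧
      c4Excess 2 4 [([6, 2], 1)] [6, 1] 0 [0, 1] = some 1 ∧
      hpCond4 2 4 [([6, 2], 1)] [6, 0] 0 [0, 1] = false := by
  decide

/-! ## 3. The oasis bound -/

/-- Hauser's surface Fact `shade_a f ≤ ⌊shade_{a°} f° / 2⌋` as a Boolean on the pair (oasis shade, antelope shade).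
[cite: Hauser2010, §J p. 24 (Fact)] -/
def oasisBound (oasis antelope : ℕ) : Bool := decide (2 * antelope ≤ oasis)

/-- Hauser's example: oasis = the root (shade `5`), antelope shade `2 ≤ ⌊5/2⌋`. The dimension-4 `E₈` row: oasis = the
root (shade `3`), antelope `1 ≤ 1`. Bérczi's Lemma-2 THREEFOLD: oasis = the root (shade `13`, no exceptional
component), antelope shade `9 > 6` — the surface bound evaluates to `false` on this three-fold row (the net change
root → kangaroo is still a decrease, `13 → 10`). (computation) [cite: Hauser2010, §J p. 24] [cite: Berczi2026, Lemma 2] -/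
theorem oasis_rows :
    oasisBound (shade ⟨hauserF, [0, 0]⟩) (shade ⟨[([5, 3], 1), ([3, 5], 1)], [3, 3]⟩) = true ∧
      oasisBound (shade ⟨e8F, [0, 0, 0]⟩) (shade ⟨[([1, 2, 1], 1), ([2, 1, 3], 1)], [1, 1, 1]⟩) = true ∧
      oasisBound (shade ⟨[([0, 4, 9], 1), ([9, 8, 10], 1)], [0, 0, 0]⟩)
          (shade ⟨[([10, 20, 9], 1), ([24, 39, 10], 1)], [10, 20, 0]⟩) = false := by
  decide

/-! ## 4. A full point-blow-up walk on Bérczi's threefold: the kangaroo shade exceeds the oasis shade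

Hauser's Fact is stated for surfaces, with the remark "It seems challenging to establish a similar statement for
singular three-folds in four-space" [cite: Hauser2010, §J p. 24]. The walk below is a computation in the model of this
file (hypersurface `x^q + F(y)` over `𝔽_p`, shade = order of the cleaned `F` minus the exceptional multiplicities,
point blow-ups, `D' = D^strict + (ord F − q)·Y'`): along it the shade at the kangaroo point (`10`) EXCEEDS the shade
at the oasis point (`9`), so the compensation mechanism of the surface Fact does not take place on this three-fold
(in the model; no claim is made about the invariants of [cite: Berczi2026]).

`decide` cannot evaluate `Nat.choose` on the exponents met here (`(y + 1)^71`), so the walk is evaluated through a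
twin of `translate` with factorial binomials, proved equal to it; the certified statement is about `stepS` itself. -/

/-- binomial coefficient by the factorial formula (kernel-friendly). [folklore] -/
def chooseF (n k : ℕ) : ℕ := if k ≤ n then n.factorial / (k.factorial * (n - k).factorial) else 0

/-- the factorial formula agrees with `Nat.choose`. [folklore] -/
theorem chooseF_eq (n k : ℕ) : chooseF n k = Nat.choose n k := by
  unfold chooseF
  split_ifs with h
  · exact (Nat.choose_eq_factorial_div_factorial h).symm
  · exact (Nat.choose_eq_zero_of_lt (by omega)).symm

/-- `translateVar` with factorial binomials. [folklore] -/
def translateVarF (p i b : ℕ) (P : Poly) : Poly :=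
  normalize p (P.flatMap (fun t =>
    let n := t.1.getD i 0
    (List.range (n + 1)).map (fun k => (t.1.set i k, t.2 * chooseF n k * b ^ (n - k)))))

/-- the twin agrees with `translateVar`. [folklore] -/
theorem translateVarF_eq : translateVarF = translateVar := by
  funext p i b P
  simp only [translateVarF, translateVar, chooseF_eq]

/-- `translate` with factorial binomials. [folklore] -/
def translateF (p : ℕ) (b : List ℕ) (P : Poly) : Poly :=
  (List.range b.length).foldl (fun acc i => if b.getD i 0 = 0 then acc else translateVarF p i (b.getD i 0) acc) P

/-- the twin agrees with `translate`. [folklore] -/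
theorem translateF_eq : translateF = translate := by
  funext p b P
  simp only [translateF, translate, translateVarF_eq]

/-- `stepS` with factorial binomials. [cite: Hauser2010, §F–§G] -/
def stepSF (p q : ℕ) (s : CState) (S : List ℕ) (j : ℕ) (b : List ℕ) : Option CState :=
  match ordAlong S s.F with
  | none => none
  | some oS =>
    if oS < q then none
    else
      let G := translateF p b (blowupS S j q s.F)
      if G.all (fun t => deg t.1 = 0 ∨ q ≤ deg t.1) then
        let Gc := clean q (G.filter (fun t => deg t.1 ≠ 0))
        let m := s.r.length
        let r' := (List.range m).map (fun i => if b.getD i 0 ≠ 0 then 0 else if i = j then oS - q else s.r.getD i 0)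
        let exc' := (List.range m).filter (fun i => b.getD i 0 = 0 ∧ (i = j ∨ memB i s.exc))
        some ⟨Gc, r', exc'⟩
      else none

/-- the twin agrees with `stepS`. [folklore] -/
theorem stepSF_eq (p q : ℕ) (s : CState) (S : List ℕ) (j : ℕ) (b : List ℕ) :
    stepSF p q s S j b = stepS p q s S j b := by
  unfold stepSF stepS
  rw [translateF_eq]

/-- the trace `(shade, r, exc)` of the successive states of a walk given by moves `(S, j, b)`; the trace stops at the
first inadmissible move. [cite: Hauser2010, §F–§G] -/
def walkTrace (p q : ℕ) : CState → List (List ℕ × ℕ × List ℕ) → List (ℕ × List ℕ × List ℕ)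
  | s, [] => [(s.shade, s.r, s.exc)]
  | s, (S, j, b) :: rest =>
    (s.shade, s.r, s.exc) :: (match stepS p q s S j b with
      | none => []
      | some s' => walkTrace p q s' rest)

/-- `walkTrace` through `stepSF`. [folklore] -/
def walkTraceF (p q : ℕ) : CState → List (List ℕ × ℕ × List ℕ) → List (ℕ × List ℕ × List ℕ)
  | s, [] => [(s.shade, s.r, s.exc)]
  | s, (S, j, b) :: rest =>
    (s.shade, s.r, s.exc) :: (match stepSF p q s S j b with
      | none => []
      | some s' => walkTraceF p q s' rest)

/-- the twin agrees with `walkTrace`. [folklore] -/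
theorem walkTraceF_eq (p q : ℕ) (s : CState) (mv : List (List ℕ × ℕ × List ℕ)) :
    walkTraceF p q s mv = walkTrace p q s mv := by
  induction mv generalizing s with
  | nil => rfl
  | cons m rest ih =>
    obtain ⟨S, j, b⟩ := m
    rw [walkTraceF, walkTrace, stepSF_eq]
    cases stepS p q s S j b with
    | none => rfl
    | some s' => exact congrArg _ (ih s')

/-- Bérczi's Lemma-2 threefold (cleaned root `F = y⁴w⁹ + x⁹y⁸w¹⁰` in `(x, y, w)`, `p = q = 3`, no exceptional
divisor), the point-blow-up walk: chart `y` (origin) → chart `x` (origin) → chart `y` (origin) = the ANTELOPE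
(`F = x¹⁶y³²w⁹ + x⁴⁰y⁷¹w¹⁰`, `r = (16, 32, 0)`, components `E_x, E_y` through it, shade `9`) → chart `x` at `y = 1` =
the KANGAROO point (shade `10`, both `E_x` (old) and `E_y` lost: `r = (54, 0, 0)`). The components through the antelope
were created by blow-ups 2 and 3, so the OASIS point is the point reached after blow-up 1, of shade `9`: the shade does
not drop between oasis and antelope (`9 → 9 → 9`) and the kangaroo shade `10` exceeds the oasis shade; the surface
bound `2·9 ≤ 9` is `false`. (computation) [cite: Hauser2010, §J p. 24] [cite: Berczi2026, Lemma 2] -/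
theorem berczi_lemma2_oasis_walk :
    walkTrace 3 3 ⟨[([0, 4, 9], 1), ([9, 8, 10], 1)], [0, 0, 0], []⟩
        [([0, 1, 2], 1, [0, 0, 0]), ([0, 1, 2], 0, [0, 0, 0]), ([0, 1, 2], 1, [0, 0, 0]), ([0, 1, 2], 0, [0, 1, 0])] =
      [(13, [0, 0, 0], []), (9, [0, 10, 0], [1]), (9, [16, 10, 0], [0, 1]), (9, [16, 32, 0], [0, 1]),
        (10, [54, 0, 0], [0])] ∧
      oasisBound 9 9 = false := by
  refine ⟨?_, by decide⟩
  rw [← walkTraceF_eq]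
  decide +kernel

end Literature.AlgebraicGeometry.Resolution.KangarooAtlasCert
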